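import Mathlib
import HarnessLib
import Summits.Ventures.LatticeQCDFlow.Scaling.IdentityFlowStrongCoupling
import Summits.Ventures.LatticeQCDFlow.Scaling.IdentityFlowAcceptanceStrongCoupling

/-!
# LatticeQCDFlow / Scaling — the strong-coupling acceptance slope of the untrained U(1) sampler
# is at most `√V / 2`, while its ESS coefficient is exactly `V / 2`

HONEST FRAMING: exact (Metropolis-corrected) sampling algorithms for lattice gauge theory;
figures of merit are autocorrelation/cost numbers at stated couplings and volumes; no
continuum-physics claim.  Unit `pub-lqcd-s0-u1-a`, GEN-17, file (N).

`Scaling/IdentityFlowAcceptanceStrongCoupling` (GEN-17 (D)) proved the FIRST-ORDER law of the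
untrained (identity-flow, product-Haar proposal) independence sampler for `V` U(1) plaquettes:
`(1 − acc_V(β))/β → s_V := ½·(2π)^{−2V} ∫∫ |Σᵢ cos θᵢ − Σᵢ cos θ′ᵢ| dθ dθ′` as `β → 0⁺`, together with
the general bound `s ≤ √(Var(T)/2)`.  `Scaling/IdentityFlowStrongCoupling` (GEN-16) proved the
SECOND-ORDER ESS law with coefficient `Var(T)` and `Var(cos θ) = ½` for one angle.

This file makes the volume dependence explicit:

* `u1Uniform_eq_pi` — the rescaled Lebesgue measure `(2π)^{−V}·Leb^{⊗V}` on `(0, 2π]^V` IS the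
  product of the one-angle Haar probabilities (so Mathlib's independence API applies);
* `u1Uniform_variance_sum_cos` — **`Var(Σᵢ cos θᵢ) = V/2`** under product Haar (independence,
  `ProbabilityTheory.variance_sum_pi`): the ESS second-order coefficient of GEN-16 grows LINEARLY;
* `u1IdentityFlow_slope_le_sqrt_card` — **`s_V ≤ √V / 2`**: the first-order ACCEPTANCE slope grows
  at most like the SQUARE ROOT of the volume.

So at small `β` the untrained sampler loses acceptance like `≤ (√V/2)·β` but effective sample size
like `(V/2)·β²`: the two figures of merit scale differently with the volume, and the crossover
`β ≈ 1/√V` is where both deficits are `O(1)` — consistent with the CLT picture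
`Σᵢ cos θᵢ ≈ N(0, V/2)` (for which `½E|T − T′| = √(V/2)/√π ≈ 0.399 √V`, inside the bound `0.5 √V`).
All statements are about the explicit finite-`V` integrals; no asymptotics in `V` are claimed.
-/

noncomputable section

namespace Summit.Ventures.LatticeQCDFlow.Theory2

open MeasureTheory Real Set ProbabilityTheory Finset

section U1

variable {ι : Type*} [Fintype ι]

/-- `cos` is square integrable under the one-angle Haar probability `(2π)⁻¹dθ` on `(0, 2π]`.
[folklore] -/
theorem memLp_two_cos_uniform :
    MemLp (fun θ => Real.cos θ) 2
      ((ENNReal.ofReal (2 * π))⁻¹ • volume.restrict (Ioc (0 : ℝ) (2 * π))) := by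
  haveI := isProbabilityMeasure_uniform_Ioc
  exact MemLp.of_bound Real.continuous_cos.aestronglyMeasurable 1
    (ae_of_all _ fun θ => by rw [Real.norm_eq_abs]; exact Real.abs_cos_le_one θ)

/-- **The rescaled product Lebesgue measure `(2π)^{−V}·Leb^{⊗V}` on `(0, 2π]^V` equals the product of
the one-angle Haar probabilities `(2π)⁻¹dθ`.** [folklore] -/
theorem u1Uniform_eq_pi :
    (ENNReal.ofReal (∏ _i : ι, (1 / (2 * π) : ℝ)))
        • Measure.pi (fun _ : ι => volume.restrict (Ioc (0 : ℝ) (2 * π)))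
      = Measure.pi fun _ : ι =>
          (ENNReal.ofReal (2 * π))⁻¹ • volume.restrict (Ioc (0 : ℝ) (2 * π)) := by
  haveI := isProbabilityMeasure_uniform_Ioc
  refine (Measure.pi_eq fun s _ => ?_).symm
  rw [Measure.smul_apply, smul_eq_mul, Measure.pi_pi]
  simp only [Measure.smul_apply, smul_eq_mul]
  rw [prod_mul_distrib, prod_const, card_univ, prod_const, card_univ, one_div,
    ENNReal.ofReal_pow (by positivity), ENNReal.ofReal_inv_of_pos (by positivity : (0 : ℝ) < 2 * π)]

/-- **`Var(Σᵢ cos θᵢ) = V/2` under product Haar on `V` U(1) plaquette angles** — the plaquette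
cosines are independent with variance `½` each (`Scaling/IdentityFlowStrongCoupling`,
`variance_cos_uniform`).  This is the SECOND-order strong-coupling ESS coefficient of the untrained
`V`-plaquette sampler. [ours] -/
theorem u1Uniform_variance_sum_cos :
    variance (fun x : ι → ℝ => ∑ i, Real.cos (x i))
        ((ENNReal.ofReal (∏ _i : ι, (1 / (2 * π) : ℝ)))
          • Measure.pi (fun _ : ι => volume.restrict (Ioc (0 : ℝ) (2 * π))))
      = Fintype.card ι / 2 := by
  haveI := isProbabilityMeasure_uniform_Ioc
  rw [u1Uniform_eq_pi]
  have h := variance_sum_pi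
    (μ := fun _ : ι => (ENNReal.ofReal (2 * π))⁻¹ • volume.restrict (Ioc (0 : ℝ) (2 * π)))
    (X := fun (_ : ι) (θ : ℝ) => Real.cos θ) fun _ => memLp_two_cos_uniform
  simp only [variance_cos_uniform, sum_const, card_univ] at h
  rw [show (fun x : ι → ℝ => ∑ i, Real.cos (x i)) = ∑ i : ι, fun x : ι → ℝ => Real.cos (x i) by
    funext x; simp only [Finset.sum_apply]]
  rw [h]
  ring

/-- **THE STRONG-COUPLING ACCEPTANCE SLOPE OF THE UNTRAINED U(1) SAMPLER IS AT MOST `√V / 2`**: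
`½·(2π)^{−2V} ∫∫ |Σᵢ cos θᵢ − Σᵢ cos θ′ᵢ| dθ dθ′ ≤ √V / 2` — the limit of `(1 − acc_V(β))/β` as
`β → 0⁺` (`u1IdentityFlow_one_sub_meanAccept_div_tendsto`) is bounded by `√(Var/2) = √(V/4)`.
[ours] -/
theorem u1IdentityFlow_slope_le_sqrt_card :
    1 / 2 * ((∏ _i : ι, (1 / (2 * π) : ℝ)) ^ 2
        * ∫ x, ∫ x', |∑ i, Real.cos (x i) - ∑ i, Real.cos (x' i)|
          ∂(Measure.pi fun _ : ι => volume.restrict (Ioc (0 : ℝ) (2 * π)))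
          ∂(Measure.pi fun _ : ι => volume.restrict (Ioc (0 : ℝ) (2 * π))))
      ≤ Real.sqrt (Fintype.card ι) / 2 := by
  have hq0 : 0 ≤ ∏ _i : ι, (1 / (2 * π) : ℝ) := prod_nonneg fun _ _ => by positivity
  haveI : IsProbabilityMeasure ((ENNReal.ofReal (∏ _i : ι, (1 / (2 * π) : ℝ)))
      • Measure.pi fun _ : ι => volume.restrict (Ioc (0 : ℝ) (2 * π))) :=
    u1Uniform_isProbabilityMeasure
  have hint : ∀ γ : ℝ, Integrable (fun x : ι → ℝ => Real.exp (γ * ∑ i, Real.cos (x i)))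
      ((ENNReal.ofReal (∏ _i : ι, (1 / (2 * π) : ℝ)))
      • Measure.pi fun _ : ι => volume.restrict (Ioc (0 : ℝ) (2 * π))) := fun γ => by
    have h1 : Integrable (fun x : ι → ℝ => ∏ i, Real.exp (γ * Real.cos (x i)))
        (Measure.pi fun _ : ι => volume.restrict (Ioc (0 : ℝ) (2 * π))) :=
      Integrable.fintype_prod_dep (μ := fun _ : ι => volume.restrict (Ioc (0 : ℝ) (2 * π)))
        fun _ => integrableOn_exp_mul_cos γ
    exact (h1.congr (ae_of_all _ fun x => by simp only; rw [mul_sum, Real.exp_sum])).smul_measure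
      ENNReal.ofReal_ne_top
  have h := half_integral_abs_sub_le_sqrt_variance
    (μ := ((ENNReal.ofReal (∏ _i : ι, (1 / (2 * π) : ℝ)))
      • Measure.pi fun _ : ι => volume.restrict (Ioc (0 : ℝ) (2 * π))))
    (T := fun x : ι → ℝ => ∑ i, Real.cos (x i)) one_pos (fun γ _ => hint γ)
  have hconst : 1 / 2 * ∫ x, ∫ x', |∑ i, Real.cos (x i) - ∑ i, Real.cos (x' i)|
      ∂((ENNReal.ofReal (∏ _i : ι, (1 / (2 * π) : ℝ)))
      • Measure.pi fun _ : ι => volume.restrict (Ioc (0 : ℝ) (2 * π)))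
      ∂((ENNReal.ofReal (∏ _i : ι, (1 / (2 * π) : ℝ)))
      • Measure.pi fun _ : ι => volume.restrict (Ioc (0 : ℝ) (2 * π)))
      = 1 / 2 * ((∏ _i : ι, (1 / (2 * π) : ℝ)) ^ 2
        * ∫ x, ∫ x', |∑ i, Real.cos (x i) - ∑ i, Real.cos (x' i)|
          ∂(Measure.pi fun _ : ι => volume.restrict (Ioc (0 : ℝ) (2 * π)))
          ∂(Measure.pi fun _ : ι => volume.restrict (Ioc (0 : ℝ) (2 * π)))) := by
    simp_rw [integral_smul_measure, smul_eq_mul, ENNReal.toReal_ofReal hq0, integral_const_mul]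
    ring
  rw [hconst, u1Uniform_variance_sum_cos] at h
  calc _ ≤ Real.sqrt (Fintype.card ι / 2 / 2) := h
    _ = Real.sqrt (Fintype.card ι) / 2 := by
      rw [div_div, show (2 : ℝ) * 2 = 2 ^ 2 by norm_num,
        Real.sqrt_div' _ (by positivity : (0 : ℝ) ≤ 2 ^ 2), Real.sqrt_sq (by norm_num : (0 : ℝ) ≤ 2)]

/-- The same bound for the LIMIT of `(1 − acc_V(β))/β`: the untrained `V`-plaquette U(1) sampler's
acceptance deficit per unit coupling tends, as `β → 0⁺`, to a constant `≤ √V / 2`. [ours] -/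
theorem u1IdentityFlow_one_sub_meanAccept_div_tendsto_le :
    ∃ s : ℝ, s ≤ Real.sqrt (Fintype.card ι) / 2 ∧
      Filter.Tendsto (fun β : ℝ => (1 - ∫ x, ∫ x',
        min ((∏ i : ι, Real.exp (β * Real.cos (x i)) / Scoring.onePlaquetteZ β)
              * ∏ _i : ι, (1 / (2 * π) : ℝ))
          ((∏ i : ι, Real.exp (β * Real.cos (x' i)) / Scoring.onePlaquetteZ β)
              * ∏ _i : ι, (1 / (2 * π) : ℝ))
        ∂(Measure.pi fun _ : ι => volume.restrict (Ioc (0 : ℝ) (2 * π)))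
        ∂(Measure.pi fun _ : ι => volume.restrict (Ioc (0 : ℝ) (2 * π)))) / β)
      (nhdsWithin 0 (Ioi 0)) (nhds s) :=
  ⟨_, u1IdentityFlow_slope_le_sqrt_card, u1IdentityFlow_one_sub_meanAccept_div_tendsto⟩

end U1

end Summit.Ventures.LatticeQCDFlow.Theory2
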